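import Summits.BirchSwinnertonDyer.BirchSwinnertonDyer.Theorems.ErratumRoadFiveJetchevAtPDisplay
import Summits.BirchSwinnertonDyer.BirchSwinnertonDyer.Theorems.ErratumRoadFiveJetchevAtPSharpBound
import Summits.BirchSwinnertonDyer.BirchSwinnertonDyer.Theorems.ErratumRoadFiveNonSurjCornerTamagawaCarriers
import Summits.BirchSwinnertonDyer.BirchSwinnertonDyer.Theses.ErratumRoadFive
import Literature.NumberTheory.EllipticCurves.PAdicBSDSplitMultiplicativeProofs
import Literature.NumberTheory.EllipticCurves.RootNumberTwistProofs
import HarnessLib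

/-!
# PORT 3 ↦ p, layer 4 (crux `EulerHalfNotRamNoInertSetAtFive`, item stmt-BirchSwinnertonDyer-19715, line birth v4; RULING 52):
# the skeleton's piece S1b («`p` the ONLY multiplicative prime, a split carrier») — and v1's S1 and the rung `stub_rung_res_605a1` —
# VERBATIM as conclusions, FROM PRINT: the two route items `PublishedInputsFive` (19066) ∕ `X11aLowerHalf` (19064) and FIVE printed named facts,
# the deciding stub `stub_jetchevAtP` BYPASSED

Cell `bsd-stepL`, seat `bsd-line-er5-p1-w2` (D-0154 width seat -w2; lead `bsd-line-er5-p1`), `--supports stmt-BirchSwinnertonDyer-19715` (helper).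

WHAT THIS FILE SHOWS. Skeleton v4 (`Cruxes/EulerHalfNotRamNoInertSetAtFive/Lines/birth.lean`, plan g40) consumes the deciding stub `stub_jetchevAtP`
(Jetchev's `K`-bound with the Tamagawa term at `q := p ∣ N`, for EVERY Heegner frame — strictly more than the port delivers: even `d_K`, `p ∣ d_K`,
levels `N ≠ N_E` included) at exactly ONE place: `res_pOnlyMultCarrierAtFive_of_jetchevAtP h₅ h₃ stub_jetchevAtP` = piece S1b. This file proves THAT
CONSUMER'S CONCLUSION (S1b's text verbatim) WITHOUT `stub_jetchevAtP`, from `h₅ : PublishedInputsFive`, `h₃ : X11aLowerHalf` and five PRINTED named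
facts taken BY NAME as hypotheses — McCallum 1991 Prop. 5.2 (`h52`) and Prop. 4.4 (`h44`), Poitou–Tate duality for Selmer structures with
conjugation-compatible invariants (`hPT`; Neukirch III §6, Milne ADT I.4.10), Gross 1991's `y_K − [torsion] ∈ E₀` (`hF1`), McCallum 1991 Cor. 5.6
upper form (`hMcU`) — by composing the port: layer 2b TARGET (A) `AtP.Koly.jetchevMaxHLAtP_of_facts_of_print` (global `p^s`-divisibility of the
derived Heegner classes to depth `ord_p c_v` at EVERY place `v`, `v = (p)` allowed) ⟶ layer 3 TARGET (B)
`AtP.Koly.missingUpperBoundAt_atP_of_classX11b_of_surj_of_not_ram_of_monoCarrier_of_jetchevMaxHL_of_lowerX11a` at the MONO-CARRIER `v = (p)`: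
on S1b's locus `p` is the only multiplicative prime and is split, so the place over `p` is the unique split multiplicative place and carries all of
`t = ord_p ∏_ℓ c_ℓ(E)` (`CornerLocal.padicValNat_tamagawaNumberAt_eq_of_unique_split`, corner-p2; additive `c_ℓ ≤ 4 < p`).

* `hasSplitMultiplicativeReductionAtPrime_of_dvd_tamagawaProduct_of_onlyMult` — `p ≥ 5`, `p ∣ ∏c`, every multiplicative prime `= p` ⟹ `p` split
  (the split place that `p ∣ ∏c` forces lies over a multiplicative prime, hence over `p`);
* `monoCarrier_of_onlyMult_of_split` — then `∃ v, ord_p ∏_ℓ c_ℓ(E) ≤ ord_p c_v(E)` (the place over `p`);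
* **`stub_res_pOnlyMultCarrierAtFive_of_print`** — S1b VERBATIM ⟸ `PublishedInputsFive`, `X11aLowerHalf`, `h52 h44 hPT hF1 hMcU`;
* `stub_res_pOnlyMultAtFive_of_print` — v1's registered S1 `stub_res_pOnlyMultAtFive` (plan g26) VERBATIM, same inputs (its `p ∣ ∏c` gives the split);
* `stub_rung_res_605a1_of_print` — v4's plan-only rung `stub_rung_res_605a1` (conclusion verbatim), same inputs, by specialisation.

So, for the LINE: modulo the two route items, the crux's piece S1b (334 R1a census pairs at `p = 5`, `N < 5·10⁵`) rests on FIVE PRINTED FACTS and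
no longer on the beyond-print binder `stub_jetchevAtP`; a v5 reshape may replace `stub_jetchevAtP` by the held-facts idiom (RULING 16 A1) over
`h52 ∧ h44 ∧ hPT ∧ hF1 ∧ hMcU` — the lead's / planner's call, not made here. INHERITED BINDERS stay visible (P5): `h52`/`h44` carry McCallum's
tower-surjectivity hypothesis (discharged inside layer 2b by the Tate-line tower lemma) and the flag Kolyvagin1991-LNM1479-primary-unread (r2);
`hPT` is typed, not proved, in the tree.

HONEST FRAMING: CONDITIONAL on `PublishedInputsFive`, `X11aLowerHalf` (OPEN crux of route x11a) and the five named facts (hypotheses, cite-only);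
THEOREMS ONLY — no `def`, no new named fact, no `sorry`; helper (`--supports`), NO stub credit claimed (the registered `stub_jetchevAtP` is NOT
proved — it is bypassed; the registered rung has no fact binders); nothing booked; no census label moves (T7); BSD(E, p) is proved for NO pair by
this file and no summit statement is proved by this seat.
[cite: McCallumLMS1991, §4 Prop. 4.4, §5 Prop. 5.2, Cor. 5.6 (p. 310)] [cite: Jetchev2008, Thm. 1.4 and Cor. 1.5 (p. 812)] [cite: GrossLMS1991, §6, Prop. 5.3]
[cite: MilneADT2006, Ch. I, Thm. 4.10] [cite: SilvermanATAEC1994, Cor. IV.9.2 (d), Table 4.1] [cite: Cremona1997, Table 1 (curve 605a1)] [cite: Miller2011LMS, Def. 1.1]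
-/

set_option linter.dupNamespace false -- `Summit.BirchSwinnertonDyer.BirchSwinnertonDyer` (summit = problem), tree-wide
set_option autoImplicit false

noncomputable section

open scoped Classical NumberField

namespace Summit.BirchSwinnertonDyer.BirchSwinnertonDyer.Theorems.JetchevAtPPrint

open WeierstrassCurve IsDedekindDomain NumberField Literature.NumberTheory.EllipticCurves
  Literature.NumberTheory.EllipticCurves.ModularForms Literature.NumberTheory.EllipticCurves.McCallum1991
  Literature.NumberTheory.EllipticCurves.Rank1Residual Literature.NumberTheory.GaloisCohomology
  Summit.BirchSwinnertonDyer.Rank1Residual Summit.BirchSwinnertonDyer.Rank1Residual.X11b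
  Summit.BirchSwinnertonDyer.BirchSwinnertonDyer.Theses.ErratumRoadFive
  Summit.BirchSwinnertonDyer.BirchSwinnertonDyer.Theorems

/-! ### §1 The carrier on S1's locus: the place over `p` is the unique split multiplicative place -/

/-- **`p ≥ 5`, `p ∣ ∏_ℓ c_ℓ(E)`, every multiplicative prime of `E` equals `p` ⟹ `E` is SPLIT multiplicative at `p`.** `p ∣ ∏c` with `p ≥ 5`
forces a split multiplicative place `v` (additive `c ≤ 4`, non-split `c ≤ 2`; `CornerLocal.dvd_tamagawaProduct_iff_exists_split`); its prime is
multiplicative, hence `= p`. [cite: SilvermanATAEC1994, Cor. IV.9.2 (d) and Table 4.1] -/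
theorem hasSplitMultiplicativeReductionAtPrime_of_dvd_tamagawaProduct_of_onlyMult
    (W : WeierstrassCurve ℚ) [W.IsElliptic] (p : ℕ) [Fact p.Prime] (hp5 : 5 ≤ p)
    (htam : p ∣ W.tamagawaProduct)
    (honly : ∀ (ℓ : ℕ) [Fact ℓ.Prime], W.HasMultiplicativeReductionAtPrime ℓ → ℓ = p) :
    W.HasSplitMultiplicativeReductionAtPrime p := by
  obtain ⟨v, hs, -⟩ := (CornerLocal.dvd_tamagawaProduct_iff_exists_split W p hp5).mp htam
  have hm := (WeierstrassCurve.hasMultiplicativeReductionAtPrime_iff_hasMultiplicativeReductionAt_ringOfIntegers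
    (W := W) v).mpr hs.hasMultiplicativeReductionAt
  have hvp : (Rat.HeightOneSpectrum.primesEquiv v : ℕ) = p :=
    @honly _ (Fact.mk (Rat.HeightOneSpectrum.primesEquiv v).2) hm
  have hs' := (WeierstrassCurve.hasSplitMultiplicativeReductionAtPrime_iff_hasSplitMultiplicativeReductionAt W v).mpr hs
  have key : ∀ (q : ℕ) (hq : q.Prime), (haveI := Fact.mk hq; W.HasSplitMultiplicativeReductionAtPrime q) →
      q = p → W.HasSplitMultiplicativeReductionAtPrime p := by
    rintro q hq h rfl
    exact h
  exact key _ (Rat.HeightOneSpectrum.primesEquiv v).2 hs' hvp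

/-- **MONO-CARRIER on S1b's locus: `∃ v, ord_p ∏_ℓ c_ℓ(E) ≤ ord_p c_v(E)`** — for `p ≥ 5`, every multiplicative prime `= p` and `p` split, the
place over `p` is the UNIQUE split multiplicative place, so it carries all of `ord_p ∏c` (`CornerLocal.padicValNat_tamagawaNumberAt_eq_of_unique_split`).
[cite: SilvermanATAEC1994, Cor. IV.9.2 (d) and Table 4.1] [cite: Jetchev2008, §1, Thm. 1.4 (the exponents ord_p c_q)] -/
theorem monoCarrier_of_onlyMult_of_split (W : WeierstrassCurve ℚ) [W.IsElliptic] (p : ℕ) [Fact p.Prime] (hp5 : 5 ≤ p)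
    (honly : ∀ (ℓ : ℕ) [Fact ℓ.Prime], W.HasMultiplicativeReductionAtPrime ℓ → ℓ = p)
    (hsplit : W.HasSplitMultiplicativeReductionAtPrime p) :
    ∃ v : HeightOneSpectrum (𝓞 ℚ), padicValNat p W.tamagawaProduct ≤ padicValNat p (W.tamagawaNumberAt v) := by
  have hp : p.Prime := Fact.out
  set v₀ : HeightOneSpectrum (𝓞 ℚ) := (Rat.HeightOneSpectrum.primesEquiv (R := 𝓞 ℚ)).symm ⟨p, hp⟩ with hv₀def
  have hv₀ : Rat.HeightOneSpectrum.primesEquiv v₀ = ⟨p, hp⟩ := Equiv.apply_symm_apply _ _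
  have hs : W.HasSplitMultiplicativeReductionAt v₀ := by
    rw [← WeierstrassCurve.hasSplitMultiplicativeReductionAtPrime_iff_hasSplitMultiplicativeReductionAt W v₀]
    have key : ∀ (q : Nat.Primes), q = ⟨p, hp⟩ → (haveI := Fact.mk q.2; W.HasSplitMultiplicativeReductionAtPrime q) := by
      rintro q rfl
      exact hsplit
    exact key _ hv₀
  have huniq : ∀ v, W.HasSplitMultiplicativeReductionAt v → v = v₀ := fun v hv ↦ by
    have hm := (WeierstrassCurve.hasMultiplicativeReductionAtPrime_iff_hasMultiplicativeReductionAt_ringOfIntegers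
      (W := W) v).mpr hv.hasMultiplicativeReductionAt
    have hvp : (Rat.HeightOneSpectrum.primesEquiv v : ℕ) = p :=
      @honly _ (Fact.mk (Rat.HeightOneSpectrum.primesEquiv v).2) hm
    apply (Rat.HeightOneSpectrum.primesEquiv (R := 𝓞 ℚ)).injective
    rw [hv₀]
    exact Subtype.ext hvp
  exact ⟨v₀, (CornerLocal.padicValNat_tamagawaNumberAt_eq_of_unique_split W p hp5 hs huniq).ge⟩

/-! ### §2 S1b, S1 and the rung, VERBATIM, from the two route items and five printed facts -/

/-- **Piece S1b of skeleton v4 (= the conclusion of `Birth.res_pOnlyMultCarrierAtFive_of_jetchevAtP`) — VERBATIM — FROM PRINT, `stub_jetchevAtP`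
BYPASSED.** For every globally minimal `W/ℚ` and prime `p` with `ClassX11b W p`, `5 ≤ p`, `ρ̄_{E,p}` onto, ¬(ram), `p ∣ ∏c`, every multiplicative
prime `= p`, `p` split, `p ∣ ord_p Δ_min`: `Typed.MissingUpperBoundAt W p` (`ord_p #Ш(E) ≤ ord_p #Ш(E)_an`), from `PublishedInputsFive` (uses its
conjuncts Gross–Zagier, Kolyvagin, GZK, modularity, newform, Hoffstein–Luo, Mazur's Manin bound), `X11aLowerHalf` (the odd Heegner twist `E^{d_K}`
is an X11a pair at `p`) and the five printed facts `h52 h44 hPT hF1 hMcU`. Proof: layer 3 (B) at the mono-carrier `v = (p)` (§1) with `hJmax :=`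
layer 2b (A). CONDITIONAL on the displayed hypotheses; helper; nothing booked; BSD(E,p) is proved for no pair by this.
[cite: McCallumLMS1991, §4 Prop. 4.4, §5 Prop. 5.2, Cor. 5.6 (p. 310)] [cite: Jetchev2008, Thm. 1.4 and Cor. 1.5 (p. 812)] [cite: GrossLMS1991, §6, Prop. 5.3]
[cite: MilneADT2006, Ch. I, Thm. 4.10] [cite: Miller2011LMS, Def. 1.1] -/
theorem stub_res_pOnlyMultCarrierAtFive_of_print (h₅ : PublishedInputsFive) (h₃ : X11aLowerHalf)
    -- FIVE PRINTED NAMED FACTS (cite-only; hypotheses)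
    (h52 : prop52_exists_conductor_kolyvaginClass_order_eq)
    (h44 : prop44_localOrder_kolyvaginClass_mul_eq)
    (hPT : ∀ (K : Type) [Field K] [NumberField K], poitouTate_selmerStructure_duality_conj K)
    (hF1 : Gross1991_heegnerPoint_sub_ratTorsion_mem_E0)
    (hMcU : McCallum1991_padicValNat_card_sha_primary_add_le_of_globalDivisibility) :
    ∀ (W : WeierstrassCurve ℚ) [W.IsElliptic] [W.IsGloballyMinimal] (p : ℕ) [Fact p.Prime], Summit.BirchSwinnertonDyer.Rank1Residual.ClassX11b W p → 5 ≤ p → Literature.NumberTheory.EllipticCurves.Rank1Residual.Surj W p → ¬ Literature.NumberTheory.EllipticCurves.Rank1Residual.Ram W p → p ∣ W.tamagawaProduct → (∀ (ℓ : ℕ) [Fact ℓ.Prime], W.HasMultiplicativeReductionAtPrime ℓ → ℓ = p) → W.HasSplitMultiplicativeReductionAtPrime p → p ∣ padicValInt p W.minimalDiscriminantInt → Literature.NumberTheory.EllipticCurves.Rank1Residual.Typed.MissingUpperBoundAt W p := by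
  obtain ⟨hGZ, hKo, -, -, -, hGZK, hmod, hnf, hHL, -, hMaz, -, -, -, -⟩ := h₅
  intro W _ _ p _ hX hp5 hsurj hnram _ honly hsplit _
  exact AtP.Koly.missingUpperBoundAt_atP_of_classX11b_of_surj_of_not_ram_of_monoCarrier_of_jetchevMaxHL_of_lowerX11a p
    hGZ hKo hGZK hmod hnf hHL hMaz hMcU (AtP.Koly.jetchevMaxHLAtP_of_facts_of_print p hX.2.1 h52 h44 hGZ hmod hPT hF1)
    (fun Wd _ _ hXa ↦ h₃ Wd p hXa) W hX hsurj hnram (monoCarrier_of_onlyMult_of_split W p hp5 honly hsplit)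

/-- **v1's registered S1 `stub_res_pOnlyMultAtFive` (plan g26) — VERBATIM as conclusion — FROM PRINT**, same inputs (its locus omits «p split» and
«p ∣ ord_pΔ_min»; `p ∣ ∏c` with `p ≥ 5` and every multiplicative prime `= p` already forces the split, §1). CONDITIONAL; helper; nothing booked.
[cite: McCallumLMS1991, §5 Prop. 5.2, Cor. 5.6] [cite: Jetchev2008, Thm. 1.4 and Cor. 1.5 (p. 812)] [cite: SilvermanATAEC1994, Cor. IV.9.2 (d)] [cite: Miller2011LMS, Def. 1.1] -/
theorem stub_res_pOnlyMultAtFive_of_print (h₅ : PublishedInputsFive) (h₃ : X11aLowerHalf)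
    (h52 : prop52_exists_conductor_kolyvaginClass_order_eq)
    (h44 : prop44_localOrder_kolyvaginClass_mul_eq)
    (hPT : ∀ (K : Type) [Field K] [NumberField K], poitouTate_selmerStructure_duality_conj K)
    (hF1 : Gross1991_heegnerPoint_sub_ratTorsion_mem_E0)
    (hMcU : McCallum1991_padicValNat_card_sha_primary_add_le_of_globalDivisibility) :
    ∀ (W : WeierstrassCurve ℚ) [W.IsElliptic] [W.IsGloballyMinimal] (p : ℕ) [Fact p.Prime], Summit.BirchSwinnertonDyer.Rank1Residual.ClassX11b W p → 5 ≤ p → Literature.NumberTheory.EllipticCurves.Rank1Residual.Surj W p → ¬ Literature.NumberTheory.EllipticCurves.Rank1Residual.Ram W p → p ∣ W.tamagawaProduct → (∀ (ℓ : ℕ) [Fact ℓ.Prime], W.HasMultiplicativeReductionAtPrime ℓ → ℓ = p) → Literature.NumberTheory.EllipticCurves.Rank1Residual.Typed.MissingUpperBoundAt W p := by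
  obtain ⟨hGZ, hKo, -, -, -, hGZK, hmod, hnf, hHL, -, hMaz, -, -, -, -⟩ := h₅
  intro W _ _ p _ hX hp5 hsurj hnram htam honly
  exact AtP.Koly.missingUpperBoundAt_atP_of_classX11b_of_surj_of_not_ram_of_monoCarrier_of_jetchevMaxHL_of_lowerX11a p
    hGZ hKo hGZK hmod hnf hHL hMaz hMcU (AtP.Koly.jetchevMaxHLAtP_of_facts_of_print p hX.2.1 h52 h44 hGZ hmod hPT hF1)
    (fun Wd _ _ hXa ↦ h₃ Wd p hXa) W hX hsurj hnram
    (monoCarrier_of_onlyMult_of_split W p hp5 honly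
      (hasSplitMultiplicativeReductionAtPrime_of_dvd_tamagawaProduct_of_onlyMult W p hp5 htam honly))

/-- **v4's plan-only rung `stub_rung_res_605a1` (S1b at the smallest R1a pair (605a1, 5) = `[1,−1,0,−1414,−44027]`, `N = 605 = 5·11²`) — conclusion
VERBATIM — FROM PRINT**: the specialisation of `stub_res_pOnlyMultCarrierAtFive_of_print` at the curve and `p = 5`. CONDITIONAL on the two items
and the five facts; helper, no stub credit (the registered rung has no fact binders); BSD(605a1, 5) is NOT proved by this.
[cite: Cremona1997, Table 1 (curve 605a1)] [cite: McCallumLMS1991, §5 Cor. 5.6] [cite: Jetchev2008, Thm. 1.4 (p. 812)] -/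
theorem stub_rung_res_605a1_of_print (h₅ : PublishedInputsFive) (h₃ : X11aLowerHalf)
    (h52 : prop52_exists_conductor_kolyvaginClass_order_eq)
    (h44 : prop44_localOrder_kolyvaginClass_mul_eq)
    (hPT : ∀ (K : Type) [Field K] [NumberField K], poitouTate_selmerStructure_duality_conj K)
    (hF1 : Gross1991_heegnerPoint_sub_ratTorsion_mem_E0)
    (hMcU : McCallum1991_padicValNat_card_sha_primary_add_le_of_globalDivisibility)
    [((⟨1, -1, 0, -1414, -44027⟩ : WeierstrassCurve ℤ).baseChange ℚ).IsElliptic] [((⟨1, -1, 0, -1414, -44027⟩ : WeierstrassCurve ℤ).baseChange ℚ).IsGloballyMinimal] [Fact (Nat.Prime 5)] :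
    Summit.BirchSwinnertonDyer.Rank1Residual.ClassX11b ((⟨1, -1, 0, -1414, -44027⟩ : WeierstrassCurve ℤ).baseChange ℚ) 5 → 5 ≤ 5 → Literature.NumberTheory.EllipticCurves.Rank1Residual.Surj ((⟨1, -1, 0, -1414, -44027⟩ : WeierstrassCurve ℤ).baseChange ℚ) 5 → ¬ Literature.NumberTheory.EllipticCurves.Rank1Residual.Ram ((⟨1, -1, 0, -1414, -44027⟩ : WeierstrassCurve ℤ).baseChange ℚ) 5 → 5 ∣ ((⟨1, -1, 0, -1414, -44027⟩ : WeierstrassCurve ℤ).baseChange ℚ).tamagawaProduct → (∀ (ℓ : ℕ) [Fact ℓ.Prime], ((⟨1, -1, 0, -1414, -44027⟩ : WeierstrassCurve ℤ).baseChange ℚ).HasMultiplicativeReductionAtPrime ℓ → ℓ = 5) → ((⟨1, -1, 0, -1414, -44027⟩ : WeierstrassCurve ℤ).baseChange ℚ).HasSplitMultiplicativeReductionAtPrime 5 → 5 ∣ padicValInt 5 ((⟨1, -1, 0, -1414, -44027⟩ : WeierstrassCurve ℤ).baseChange ℚ).minimalDiscriminantInt → Literature.NumberTheory.EllipticCurves.Rank1Residual.Typed.MissingUpperBoundAt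 ((⟨1, -1, 0, -1414, -44027⟩ : WeierstrassCurve ℤ).baseChange ℚ) 5 :=
  stub_res_pOnlyMultCarrierAtFive_of_print h₅ h₃ h52 h44 hPT hF1 hMcU _ 5

end Summit.BirchSwinnertonDyer.BirchSwinnertonDyer.Theorems.JetchevAtPPrint

end
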